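import Literature.AnabelianGeometry.AbsoluteAnabelian.AbsTopITemperedCuspsFactRows
import Literature.AnabelianGeometry.AbsoluteAnabelian.AbsTopITemperedCuspsSchemaNegative
import Literature.AnabelianGeometry.AbsoluteAnabelian.AbsTopII.EllipticCuspidalizationComparisonSchemaRefuted
import Literature.AnabelianGeometry.AbsoluteAnabelian.AbsTopII.EllipticComparisonClosures
import Literature.AnabelianGeometry.AbsoluteAnabelian.AbsTopII.EllipticAdmissibleClosures
import Literature.AnabelianGeometry.AbsoluteAnabelian.ArchimedeanReconstructionCor28aFactRows
import Literature.AnabelianGeometry.AbsoluteAnabelian.GaloisTheatersCor52iSchema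
import Literature.AnabelianGeometry.AbsoluteAnabelian.GaloisTheatersRmk511Schema
import Literature.AnabelianGeometry.AbsoluteAnabelian.GaloisTheatersRmk511
import Literature.AnabelianGeometry.AbsoluteAnabelian.GaloisTheatersTrivialContext
import Literature.AnabelianGeometry.AbsoluteAnabelian.TPairsCyclotomeSchemaWitnesses
import Literature.AnabelianGeometry.AbsoluteAnabelian.TPairsSchemaNegative
import Literature.AnabelianGeometry.AbsoluteAnabelian.TPairsEAHomExtendsNegative
import Literature.AnabelianGeometry.AbsoluteAnabelian.PanalocalTheatersCountermodels
import Literature.AnabelianGeometry.AbsoluteAnabelian.PanalocalTheatersGeneric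
import Literature.AnabelianGeometry.AbsoluteAnabelian.AbsCuspFactsSchemaRefutations
import Literature.AnabelianGeometry.AbsoluteAnabelian.CuspidalizationFactsModelProofs
import Literature.AnabelianGeometry.AbsoluteAnabelian.AbsTopIII.CcnTransgressionSplitVanishing
import Literature.AnabelianGeometry.AbsoluteAnabelian.AbsTopIII.CurveModelSchemaWitnesses
import Literature.AnabelianGeometry.AbsoluteAnabelian.AbsTopIII.GeometricCyclotomeSyncSchema
import Literature.AnabelianGeometry.AbsoluteAnabelian.AbsTopIII.KummerSchemataClosureRefutations
import Literature.AnabelianGeometry.AbsoluteAnabelian.AbsTopIII.KummerFaithfulPadicConsequences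
import Literature.AnabelianGeometry.AbsoluteAnabelian.AbsTopIII.DivisorSectionsSchemaNegative
import Literature.AnabelianGeometry.AbsoluteAnabelian.AbsTopIII.KummerPUKerClosureRefutation
import Literature.AnabelianGeometry.AbsoluteAnabelian.AbsTopIII.CyclotomeSynchronizationSchemata
import Literature.AnabelianGeometry.AbsoluteAnabelian.AbsTopIII.CuspidalSynchronizationNeedsThirdCurve
import Literature.AnabelianGeometry.AbsoluteAnabelian.AbsTopIII.ReconstructionSchemaNegative
import Literature.AnabelianGeometry.AbsoluteAnabelian.AbsTopIII.ReconstructionToyInstances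
import Literature.AnabelianGeometry.AbsoluteAnabelian.AbsTopIII.Thm19bPresentationsProofs
import Literature.IUT.HodgeArakelov.Prop13SubClosedUniversalClosures
import Literature.IUT.HodgeArakelov.Prop13SubExample32UniversalClosures
import Literature.IUT.HodgeTheaters.ThetaNFHodgeTheatersCor56iiHTRClosureCertificate
import Literature.IUT.HodgeTheaters.ThetaNFHodgeTheatersProofs2
import Literature.IUT.HodgeTheaters.FactListL5GlobalFrobenioidsSchemas
import Literature.IUT.HodgeTheaters.FrobenioidBridgeModelsEx54viIndependence
import Literature.IUT.HodgeTheaters.FrobenioidBridgeModelsEx54viSchema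
import Literature.IUT.LogVolume.Corollary22Statement
import Summits.ABC.ABC.Theses.IUTThetaPilot
import HarnessLib

/-!
# RESCUER-39 · PARTITION B (NEG-AS-TYPED-39 rows 21–39) — kernel name-pins + the width-0 observation

abc-iut-inv-1 (technique-rotating ideation seat, gen 3, cycle 3, lens `rescuer`; KEY
`pub/abc-iut/wake/KEY-abc-iut-inv-1-RESCUER-39B.md`, stamp e9df1f6fa9241cea).  Companion of the memo
`RESCUE-B.md` (tree copy `Cruxes/ThetaPartII/RESCUE-39B-inv-1.md`).  This file RE-TYPES NOTHING: every
death (refuting witness) and every "rescued-by-record" instance form of rows 21–39 is pinned BY NAME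
(`example := @decl`), so the memo's citations are kernel-resolved names, and §3 records the one typed fact
behind the WIDTH column: the hypothesis record of the (P)-arm target `Cor22.Hypotheses D` has exactly the two
data-level fields `supp`, `jinv` — no slot of anabelian-reconstruction type — and the crux of record
`ThetaPartII` quantifies over `CBData` only.  No side is taken on [IUTchIII] Cor. 3.12 or on any author;
refuted-as-typed ≠ refuted-in-print; typed ≠ proved; nothing here is an abc claim; MORATORIUM rq128 untouched
(no model-point instantiation appears).  0 sorry, no `def` of mathematical content, no instance / notation.
-/

set_option linter.dupNamespace false

namespace Summit.ABC.ABC.Cruxes.ThetaPartII.RescueB1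

/-! ## §1 DEATHS — the refuting witnesses of rows 21–39, pinned by name (table column `refuting_witness`) -/

-- row 21 · AbsTopI:Prop4.10(iv) · F-0255
example := @Literature.AnabelianGeometry.AbsoluteAnabelian.not_verticialEdgeLikeCharacterized_empty
example := @Literature.AnabelianGeometry.AbsoluteAnabelian.not_forall_verticialEdgeLikeCharacterized
-- row 22 · AbsTopI:Prop4.10(vi) · F-0254
example := @Literature.AnabelianGeometry.AbsoluteAnabelian.not_forall_cuspsViaEdgeLike
-- row 23 · AbsTopII:Cor3.3(i) · F-0289 / F-0294
example := @Literature.AnabelianGeometry.AbsoluteAnabelian.AbsTopII.EllipticModel.not_forall_cor_3_3_i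
example := @Literature.AnabelianGeometry.AbsoluteAnabelian.AbsTopII.EllipticModel.forall_cor_3_3_i_imp_coHopfian
example := @Literature.AnabelianGeometry.AbsoluteAnabelian.AbsTopII.EllipticModel.not_forall_realizesCore
-- row 24 · AbsTopII:Cor3.3(ii) · F-0234 / F-0290
example := @Literature.AnabelianGeometry.AbsoluteAnabelian.AbsTopII.not_forall_cor_3_3_ii
example := @Literature.AnabelianGeometry.AbsoluteAnabelian.AbsTopII.EllipticModel.not_forall_cor_3_3_ii
-- row 25 · AbsTopIII:Cor2.8 · F-0059 / F-0062
example := @Literature.AnabelianGeometry.AbsoluteAnabelian.ArchimedeanReconstruction.AutHolWitness.not_cauchyEquiv_const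
example := @Literature.AnabelianGeometry.AbsoluteAnabelian.ArchimedeanReconstruction.not_forall_cauchyEquiv
example := @Literature.AnabelianGeometry.AbsoluteAnabelian.ArchimedeanReconstruction.AutHolWitness.not_polesAvoid_singleton
example := @Literature.AnabelianGeometry.AbsoluteAnabelian.ArchimedeanReconstruction.not_forall_polesAvoid
-- row 26 · AbsTopIII:Cor5.2(i) · F-0106 / F-0111
example := @Literature.AnabelianGeometry.AbsoluteAnabelian.not_forall_eaHomExtendsToTheaters
example := @Literature.AnabelianGeometry.AbsoluteAnabelian.GlobalAnabelianContext.exists_fieldIso_of_eaHomExtendsToTheaters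
example := @Literature.AnabelianGeometry.AbsoluteAnabelian.eaHomExtendsToTheaters_independent
example := @Literature.AnabelianGeometry.AbsoluteAnabelian.not_forall_theaterIsoCanonical
example := @Literature.AnabelianGeometry.AbsoluteAnabelian.exists_context_not_theaterIsoCanonical
-- row 27 · AbsTopIII:Cor5.2(ii) · F-0186
example := @Literature.AnabelianGeometry.AbsoluteAnabelian.not_forall_cyclotomeIsoUnique
-- row 28 · AbsTopIII:Cor5.2(iii) · F-0189 / F-0191
example := @Literature.AnabelianGeometry.AbsoluteAnabelian.not_forall_referencePairIsoUnique
example := @Literature.AnabelianGeometry.AbsoluteAnabelian.not_forall_tPairHomDeterminedByTheaterHom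
example := @Literature.AnabelianGeometry.AbsoluteAnabelian.TPairVocabulary.exists_schemaNegative
-- row 29 · AbsTopIII:Cor5.2(iv) · F-0190 / F-0192
example := @Literature.AnabelianGeometry.AbsoluteAnabelian.not_forall_tPairEAHomExtends
example := @Literature.AnabelianGeometry.AbsoluteAnabelian.not_forall_tPairIsoCanonical
-- row 30 · AbsTopIII:Cor5.2(v) · F-0182
example := @Literature.AnabelianGeometry.AbsoluteAnabelian.not_forall_panalocalizationExists
-- row 31 · AbsTopIII:Prop1.4(ii) · F-0050 / F-0338 / F-0341 / F-0365
example := @Literature.AnabelianGeometry.AbsoluteAnabelian.AbsCusp.not_forall_prop_1_6_iii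
example := @Literature.AnabelianGeometry.AbsoluteAnabelian.AbsTopIII.CurveModel.not_forall_prop_1_4_ii_transgression
example := @Literature.AnabelianGeometry.AbsoluteAnabelian.AbsTopIII.CurveModel.not_forall_prop_1_4_ii
example := @Literature.AnabelianGeometry.AbsoluteAnabelian.AbsTopIII.CurveModel.not_forall_prop_1_4_ii_sync
-- row 32 · AbsTopIII:Prop1.6(i) · F-0342 / F-0374
example := @Literature.AnabelianGeometry.AbsoluteAnabelian.AbsTopIII.not_forall_prop_1_6_i
example := @Literature.AnabelianGeometry.AbsoluteAnabelian.AbsTopIII.IntrinsicKummerModel.not_forall_prop_1_6_i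
example := @Literature.AnabelianGeometry.AbsoluteAnabelian.AbsTopIII.IntrinsicKummerModel.not_forall_prop_1_6_i'
-- row 33 · AbsTopIII:Prop1.6(ii) · F-0351
example := @Literature.AnabelianGeometry.AbsoluteAnabelian.AbsTopIII.DivisorCurveModel.not_forall_prop_1_6_ii
example := @Literature.AnabelianGeometry.AbsoluteAnabelian.AbsTopIII.DivisorCurveModel.not_forall_prop_1_6_ii_of_rmk_1_5_4_i
-- row 34 · AbsTopIII:Prop1.6(iii) · F-0045 / F-0050 / F-0343 / F-0375 / F-0378
example := @Literature.AnabelianGeometry.AbsoluteAnabelian.AbsCusp.not_forall_prop_1_6_iii_model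
example := @Literature.AnabelianGeometry.AbsoluteAnabelian.AbsTopIII.not_forall_prop_1_6_iii_units
example := @Literature.AnabelianGeometry.AbsoluteAnabelian.AbsTopIII.forall_prop_1_6_iii_units_iff_false
example := @Literature.AnabelianGeometry.AbsoluteAnabelian.AbsTopIII.IntrinsicKummerModel.not_forall_prop_1_6_iii_units
example := @Literature.AnabelianGeometry.AbsoluteAnabelian.AbsTopIII.IntrinsicKummerModel.not_forall_prop_1_6_iii_ker
-- row 35 · AbsTopIII:Thm1.9 · F-0346 / F-0399 / F-2783
example := @Literature.AnabelianGeometry.AbsoluteAnabelian.AbsTopIII.CurveModel.not_forall_thm_1_9_b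
example := @Literature.AnabelianGeometry.AbsoluteAnabelian.AbsTopIII.CurveModel.not_forall_thm_1_9_b_of_prop_1_4_package
example := @Literature.AnabelianGeometry.AbsoluteAnabelian.AbsTopIII.not_forall_thm_1_9
example := @Literature.AnabelianGeometry.AbsoluteAnabelian.AbsTopIII.not_thm_1_9_toyModel_rat
example := @Literature.IUT.HodgeArakelov.Prop13Toy.not_forall_corrIntSConventional
-- row 36 · IUTchI:Cor5.6(ii) · F-2046
example := @Literature.IUT.HodgeTheaters.BaseThetaDatum.not_forall_cor56ii_HTR
example := @Literature.IUT.HodgeTheaters.BaseThetaDatum.S5Local.not_cor56ii_HTR_of_two_lifts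
-- row 37 · IUTchI:Ex5.1(i) · F-2574 (+ F-2571, F-2572 decided at the Galois model)
example := @Literature.IUT.HodgeTheaters.NFBridgeRecon.not_forall_kappaSolConjugateSynchronization
example := @Literature.IUT.HodgeTheaters.NFBridgeRecon.not_mκIsInvariants_galoisModel
-- row 38 · IUTchI:Ex5.1(v) · F-2579
example := @Literature.IUT.HodgeTheaters.ModSolReconstruction.not_forall_recoversModel
-- row 39 · IUTchI:Ex5.4(vi) · F-2000
example := @Literature.IUT.HodgeTheaters.BaseThetaDatum.not_ex54vi_toyS5LocalLab
example := @Literature.IUT.HodgeTheaters.BaseThetaDatum.S5Local.not_forall_ex54vi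
example := @Literature.IUT.HodgeTheaters.BaseThetaDatum.S5Local.ex54vi_independent

/-! ## §2 RESCUED-BY-RECORD — the instance / conditional forms the same files already PROVE (crit-A test (iii):
a dodge whose dodged statement is a kernel theorem is census, not candidate) -/

example := @Literature.AnabelianGeometry.AbsoluteAnabelian.verticialEdgeLikeCharacterized_maxCompact      -- row 21
example := @Literature.AnabelianGeometry.AbsoluteAnabelian.cuspsViaEdgeLike_candidateClosure              -- row 22
example := @Literature.AnabelianGeometry.AbsoluteAnabelian.ArchimedeanReconstruction.NFCurveData.polesAvoid_empty      -- row 25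
example := @Literature.AnabelianGeometry.AbsoluteAnabelian.ArchimedeanReconstruction.NFCurveData.cauchyEquiv_self_iff  -- row 25
example := @Literature.AnabelianGeometry.AbsoluteAnabelian.eaHomExtendsToTheaters_of_subsingleton          -- row 26 (degenerate)
example := @Literature.AnabelianGeometry.AbsoluteAnabelian.theaterIsoCanonical_of_mapKNF_id                -- row 26 (law form)
example := @Literature.AnabelianGeometry.AbsoluteAnabelian.theaterIsoCanonical_of_forall_notMem_arc        -- row 26 (degenerate)
example := @Literature.AnabelianGeometry.AbsoluteAnabelian.panalocalizationExists_of_mapProVal_mem         -- row 30 (law form)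
example := @Literature.AnabelianGeometry.AbsoluteAnabelian.panalocalizationExists_of_forall_notMem         -- row 30 (degenerate)
example := @Literature.AnabelianGeometry.AbsoluteAnabelian.AbsTopIII.CurveModelSchemaWitness.isCuspidallyCentralExtension_toyKill_of_comm  -- row 31
example := @Literature.AnabelianGeometry.AbsoluteAnabelian.AbsTopIII.CoherentKummerModel.thm_1_9_b         -- row 35 (law form)
example := @Literature.AnabelianGeometry.AbsoluteAnabelian.AbsTopIII.Thm_1_9.exists_toyCarrier             -- row 35 (toy instance)
example := @Literature.IUT.HodgeArakelov.Prop13Sub.corrIntSConventional_ofBsGal                            -- row 35 (F-2783 instance)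
example := @Literature.IUT.HodgeTheaters.BaseThetaDatum.S5Local.cor56ii_HTR_of_baseGIso_bijective                                 -- row 36 (law form)
example := @Literature.IUT.HodgeTheaters.NFBridgeRecon.kappaSolConjugateSynchronization_galoisModel        -- row 37
example := @Literature.IUT.HodgeTheaters.NFBridgeRecon.exists_mκIsInvariants                               -- row 37
example := @Literature.IUT.HodgeTheaters.NFBridgeRecon.constantsInfκx_galoisModel                          -- row 37
example := @Literature.IUT.HodgeTheaters.BaseThetaDatum.S5Local.ex54vi_of_subsingleton                     -- row 39 (degenerate)

/-! ## §3 WIDTH toward the (P)-arm is 0 AS TYPED — the one typed fact behind the column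

The crux of record quantifies over compactly bounded DATA `D : CBData` and its hypothesis record has exactly two
fields, both data-level (support ∋ 2; (∗^{j-inv})).  No predicate over `CurveModel` / `GlobalAnabelianContext` /
`TPairVocabulary` / `NFBridgeRecon` / `S5Local` / `EllipticModel` / `IsogenyModel` / `NFCurveData` occurs as a binder
of `ThetaPartII`, of `closes`, or of the RESHAPE-4 residual `stub_cor312PerImage` (binders `AdmitsCore`, `CondP2`,
`CondP5`, `CondP6` over `NFPoint`; Theorems file `IUTThetaPilotABCOfCor312PerImageSzpiroBad.lean`).  Hence a
re-typed anabelian row C′ has no NAMED one-line implication into the (P)-arm: width 0 for rows 21–39. -/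

/-- `Cor22.Hypotheses D` is literally `supp ∧ jinv` (both fields data-level). [folklore] -/
theorem cor22Hypotheses_iff (D : Literature.NumberTheory.DiophantineGeometry.GenEll.CBData) :
    Literature.IUT.LogVolume.Cor22.Hypotheses D ↔
      (D.SupportContains {2} ∧ Literature.IUT.LogVolume.Cor22.JInvBounded D) :=
  ⟨fun h => ⟨h.supp, h.jinv⟩, fun h => ⟨h.1, h.2⟩⟩

/-- The crux of record, unfolded once: it quantifies over `CBData` only. [folklore] -/
theorem thetaPartII_iff :
    Summit.ABC.ABC.Theses.IUTThetaPilot.ThetaPartII ↔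
      ∃ HII : ℝ, ∀ D : Literature.NumberTheory.DiophantineGeometry.GenEll.CBData,
        Literature.IUT.LogVolume.Cor22.Hypotheses D → Literature.IUT.LogVolume.Cor22.PartII D HII :=
  Iff.rfl

end Summit.ABC.ABC.Cruxes.ThetaPartII.RescueB1
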